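import Mathlib.Tactic.Ring
import Mathlib.Tactic.Linarith
import Literature.Computability.Cryptography.WordRAMStructured
import Literature.Computability.Cryptography.WordRAMEmulator
import Literature.Computability.Cryptography.FGProblemZoo
import HarnessLib

/-!
# Wagner–Fischer on the word RAM: a proof of `EditDistance_inTimeO_sq`

`Literature.Computability.Cryptography.FGProblemZoo` vendors the fact
`Literature.CryptoQuantFine.EditDistance_inTimeO_sq : EditDistance.InTimeO fun n => n ^ 2` — edit
distance of two bit strings of total length `n` is computable in time `O(n²)` on the word RAM of
`Literature.Computability.Cryptography.WordRAM` — citing Wagner–Fischer, *The string-to-string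
correction problem*, J. ACM 21 (1974) 168–173, §4: the recurrence (Theorem 2), the border values
(Theorem 3) and Algorithm X, for which "the number of assignments is exactly
`1 + |A| + |B| + 4|A||B|`, so the total time is `O(|A|·|B|)`" (p. 172). This file proves it
(`EditDistance_inTimeO_sq_holds`) by exhibiting a concrete word-RAM program and verifying it
against the small-step semantics `WordRAM.step`:

* `WagnerFischer.prog` (71 instructions, registers in cells `0 … 18`, word-size constant
  `k = 8`): it first moves the input out of the register area (cells `1, 2, 3` by three unrolled
  copies through the pointer cell `0`, the rest by a loop), then fills the `(|s|+1) × (|t|+1)`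
  table of *suffix* edit distances `E i j = editDist (s.drop i) (t.drop j)` (Algorithm X run
  backwards, so that it matches the structural recursion `editDist_cons_cons`): last row, then
  row by row the last column and the recurrence, with the three-way minimum computed branch-free
  (`BinOp.min_gadget`) and `[sᵢ ≠ tⱼ]` as `1 - [sᵢ = tⱼ]`; finally it outputs `[E 0 0]`.
* `WagnerFischer.prog_run`: from the initial memory the program halts after exactly
  `22|s||t| + 16|s| + 12|t| + 43` steps with output `[editDist s t]`, provided every address and
  value fits in a word (`2|s| + 2|t| + 26 + (|s|+1)(|t|+1) ≤ 2 ^ w`, which `wordBound` derives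
  from `w = 8 · inputWidth`); `steps_le` bounds the step count by `100 n² + 100`.

The verification is organised as in Hoare logic: one invariant per loop, indexed by the loop
counter (`RelocInv`, `RowInv`, `OuterInv`, `InnerInv`), one symbolic-execution lemma per
straight-line block (`proBlock_spec`, `relocBody_spec`, `initBlock_spec`, `rowBody_spec`,
`outerBlock_spec`, `innerBody_spec`, `epilogue_spec`) on top of `WordRAM.run_ops`
(`Literature.Computability.Cryptography.WordRAMBlocks`), and a `while`-rule `run_while` for
loops whose body may itself contain loops. Overflow-free word arithmetic
(`WordRAM.BinOp.eval_add_of_lt`, `eval_sub_of_le`, `eval_mul_of_lt`), the `execOp` unfoldings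
(`WordRAM.execOp_dir`, `execOp_ind`) and the initial memory as a total function
(`WordRAM.init_mem_eq_initFun`, `init_mem_zero_of_inputWidth_le`) are the library's
(`WordRAMStructured`, `WordRAMEmulator`, `WordRAMExec`); what this file adds of general use
(namespace `Literature.CryptoQuantFine.WagnerFischer`) is only: the `while`-rule `run_while` for loops
given by an invariant whose body may itself contain loops, runs on literal configurations
(`run_ops_mk`, `run_jmp`, `run_jz_zero`, `run_jz_ne`, `run_halt`, `run_trans`),
`codeAt_of_drop_take`, `readOut_eq_singleton`, and the gadgets `BinOp.min_gadget` (branch-free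
minimum) and `BinOp.ne_gadget`.

Implementation note: memory facts `mem a = v` are kept inside structures (the invariants and
`WagnerFischer.Sealed`) and handed to `simp` as rewrite rules, so that the address-distinctness
and no-overflow side conditions are discharged by `decide` / `simp +arith` / `omega` in a small
arithmetic context (the cost of `omega` grows quickly with irrelevant hypotheses).

## References

* R. A. Wagner and M. J. Fischer, *The string-to-string correction problem*, J. ACM 21 (1974),
  168–173, §4 (Theorems 2, 3; Algorithm X; time bound p. 172). [cite: WagnerFischerJACM1974]
* V. Vassilevska Williams, *On some fine-grained questions in algorithms and complexity*,
  Proc. ICM 2018, §2 (the word-RAM conventions of `FGProblem.InTimeO`).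
-/

namespace Literature.Computability.Cryptography.WagnerFischer

open StateTransition WordRAM

/-! ## Two word gadgets: branch-free minimum and `[x ≠ y]` -/

namespace BinOp

variable {w x y : ℕ}

/-- Any `sub` result is a word. [folklore] -/
theorem eval_sub_lt (w x y : ℕ) : BinOp.sub.eval w x y < 2 ^ w :=
  Nat.mod_lt _ (Nat.two_pow_pos w)

/-- Multiplication by the word `0` gives `0`, whatever the first operand. [folklore] -/
@[simp] theorem eval_mul_zero (w x : ℕ) : BinOp.mul.eval w x 0 = 0 := by
  simp [BinOp.eval]

/-- Multiplication of a word by the word `1`. [folklore] -/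
theorem eval_mul_one (hx : x < 2 ^ w) : BinOp.mul.eval w x 1 = x := by
  simp [BinOp.eval, Nat.mod_eq_of_lt hx]

/-- **Branch-free minimum.** For a word `x`, the three instructions `d := x - y; f := [y < x];
x := x - d * f` compute `min x y` (when `y ≥ x` the wrapped difference is multiplied by `0`).
[folklore] -/
theorem min_gadget (hx : x < 2 ^ w) :
    BinOp.sub.eval w x (BinOp.mul.eval w (BinOp.sub.eval w x y) (BinOp.lt.eval w y x)) =
      min x y := by
  rw [BinOp.eval_lt]
  split_ifs with h
  · rw [eval_mul_one (eval_sub_lt w x y), BinOp.eval_sub_of_le h.le hx,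
      BinOp.eval_sub_of_le (Nat.sub_le x y) hx, Nat.sub_sub_self h.le, min_eq_right h.le]
  · rw [eval_mul_zero, BinOp.eval_sub_of_le (Nat.zero_le x) hx, Nat.sub_zero,
      min_eq_left (not_lt.mp h)]

end BinOp

/-- The word `[x ≠ y]` (`0` if `x = y`, else `1`). [folklore] -/
def neWord (x y : ℕ) : ℕ := if x = y then 0 else 1

/-- `neWord x y ≤ 1`. [folklore] -/
theorem neWord_le_one (x y : ℕ) : neWord x y ≤ 1 := by
  unfold neWord; split_ifs <;> exact Nat.le_of_lt_succ (by decide)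

/-- `neWord` unfolded. [folklore] -/
theorem neWord_eq_ite (x y : ℕ) : neWord x y = if x = y then 0 else 1 := rfl

/-- The two instructions `f := [x = y]; f := 1 - f` compute the word `[x ≠ y]`. [folklore] -/
theorem BinOp.ne_gadget {w x y : ℕ} (hw : 1 < 2 ^ w) :
    BinOp.sub.eval w 1 (BinOp.eq.eval w x y) = neWord x y := by
  rw [BinOp.eval_eq]; unfold neWord
  split_ifs with h
  · rw [BinOp.eval_sub_of_le le_rfl hw]
  · rw [BinOp.eval_sub_of_le (Nat.zero_le 1) hw]

/-! ## The initial configuration and one-word outputs -/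

/-- The initial configuration as an anonymous constructor (program counter `0`, no coins
consumed, empty query log). [folklore] -/
theorem init_eq_mk (w : ℕ) (x : List ℕ) : init w x = ⟨some 0, (init w x).mem, 0, []⟩ := rfl

/-- If `mem 0 = 1` the output read back from `mem` is the single word `mem 1`. [folklore] -/
theorem readOut_eq_singleton {mem : ℕ → ℕ} (h0 : mem 0 = 1) : readOut mem = [mem 1] := by
  simp [readOut, readSeg, h0]

/-! ## Straight-line blocks and jumps on literal configurations -/

/-- A block is at offset `i` of `P` when dropping `i` instructions and taking `|B|` gives `B`
(an equation that `rfl` decides on closed programs). [folklore] -/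
theorem codeAt_of_drop_take {P : Program} {i : ℕ} {B : List Instr}
    (h : (P.drop i).take B.length = B) : CodeAt P i B := by
  intro j I hj
  have hjl : j < B.length := (List.getElem?_eq_some_iff.1 hj).1
  have h1 : ((P.drop i).take B.length)[j]? = B[j]? := by rw [h]
  rw [List.getElem?_take, if_pos hjl, List.getElem?_drop] at h1
  rw [h1, hj]

section run

variable {P : Program} {w : ℕ} {O : List ℕ → List ℕ} {ρ : ℕ → ℕ}

/-- `run_ops` on a literal configuration. [folklore] -/
theorem run_ops_mk (ops : List OpSpec) {i : ℕ} (h : CodeAt P i (ops.map OpSpec.toInstr))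
    (mem : ℕ → ℕ) (cp : ℕ) (q : List (List ℕ)) :
    run P w O ρ ops.length ⟨some i, mem, cp, q⟩ =
      some ⟨some (i + ops.length), execOps w mem ops, cp, q⟩ :=
  run_ops ops h rfl

/-- One `jmp` as a run of length `1`. [folklore] -/
theorem run_jmp {i t : ℕ} (h : P[i]? = some (.jmp t)) (mem : ℕ → ℕ) (cp : ℕ)
    (q : List (List ℕ)) :
    run P w O ρ 1 ⟨some i, mem, cp, q⟩ = some ⟨some t, mem, cp, q⟩ := by
  rw [run_one]; exact step_jmp (c := ⟨some i, mem, cp, q⟩) rfl h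

/-- One taken `jz` as a run of length `1`. [folklore] -/
theorem run_jz_zero {i t : ℕ} {x : Operand} (h : P[i]? = some (.jz x t)) {mem : ℕ → ℕ}
    (hx : x.read mem = 0) (cp : ℕ) (q : List (List ℕ)) :
    run P w O ρ 1 ⟨some i, mem, cp, q⟩ = some ⟨some t, mem, cp, q⟩ := by
  rw [run_one]; exact step_jz_zero (c := ⟨some i, mem, cp, q⟩) rfl h hx

/-- One fall-through `jz` as a run of length `1`. [folklore] -/
theorem run_jz_ne {i t : ℕ} {x : Operand} (h : P[i]? = some (.jz x t)) {mem : ℕ → ℕ}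
    (hx : x.read mem ≠ 0) (cp : ℕ) (q : List (List ℕ)) :
    run P w O ρ 1 ⟨some i, mem, cp, q⟩ = some ⟨some (i + 1), mem, cp, q⟩ := by
  rw [run_one]; exact step_jz_ne (c := ⟨some i, mem, cp, q⟩) rfl h hx

/-- `halt` as a run of length `1`. [folklore] -/
theorem run_halt {i : ℕ} (h : P[i]? = some .halt) (mem : ℕ → ℕ) (cp : ℕ) (q : List (List ℕ)) :
    run P w O ρ 1 ⟨some i, mem, cp, q⟩ = some ⟨none, mem, cp, q⟩ := by
  rw [run_one]; exact step_halt (c := ⟨some i, mem, cp, q⟩) rfl h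

/-- Composition of two run segments with the total length given up to a (linear-arithmetic)
equation, the form in which step counts are accumulated along a program. [folklore] -/
theorem run_trans {m n N : ℕ} {c c' : Cfg} {r : Option Cfg} (h₁ : run P w O ρ m c = some c')
    (h₂ : run P w O ρ n c' = r) (hN : m + n = N) : run P w O ρ N c = r := by
  subst hN; exact run_add_of_run P w O ρ h₁ h₂

/-- **`while` loops with an arbitrary body.** Suppose `P[top] = jz (dir rc) ex` and
`P[back] = jmp top`, and `Inv m mem` is an invariant indexed by the value `m` of the counter cell
`rc` such that, from `top + 1` with `Inv (m + 1)`, the machine reaches `back` in exactly `K`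
steps re-establishing `Inv m` (the body may itself contain loops). Then from `top` with `Inv m`
it reaches `ex` in exactly `m * (K + 2) + 1` steps, with `Inv 0`. (`WordRAM.run_loop` is the
special case of a straight-line body.) [folklore] -/
theorem run_while {top ex back rc K : ℕ} {cp : ℕ} {q : List (List ℕ)}
    (htop : P[top]? = some (.jz (.dir rc) ex)) (hback : P[back]? = some (.jmp top))
    (Inv : ℕ → (ℕ → ℕ) → Prop) (hcnt : ∀ m mem, Inv m mem → mem rc = m)
    (hbody : ∀ m mem, Inv (m + 1) mem →
      ∃ mem', run P w O ρ K ⟨some (top + 1), mem, cp, q⟩ = some ⟨some back, mem', cp, q⟩ ∧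
        Inv m mem')
    (m : ℕ) (mem : ℕ → ℕ) (hI : Inv m mem) :
    ∃ mem', run P w O ρ (m * (K + 2) + 1) ⟨some top, mem, cp, q⟩ =
      some ⟨some ex, mem', cp, q⟩ ∧ Inv 0 mem' := by
  induction m generalizing mem with
  | zero =>
    refine ⟨mem, ?_, hI⟩
    have h0 : (Operand.dir rc).read mem = 0 := by simpa using hcnt 0 mem hI
    rw [zero_mul, zero_add]
    exact run_jz_zero htop h0 cp q
  | succ m ih =>
    have h1 : (Operand.dir rc).read mem ≠ 0 := by simp [hcnt (m + 1) mem hI]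
    obtain ⟨mem₁, hb, hI₁⟩ := hbody m mem hI
    obtain ⟨mem₂, hrest, hI₂⟩ := ih mem₁ hI₁
    refine ⟨mem₂, ?_, hI₂⟩
    have e : (m + 1) * (K + 2) + 1 = ((K + 1) + (m * (K + 2) + 1)) + 1 := by ring
    rw [e, run_succ_of_step P w O ρ (step_jz_ne (c := ⟨some top, mem, cp, q⟩) rfl htop h1)]
    refine run_add_of_run P w O ρ (c' := ⟨some top, mem₁, cp, q⟩) ?_ hrest
    rw [run_add_of_run P w O ρ hb]
    exact run_jmp hback mem₁ cp q

end run

/-! ## The suffix table of the edit distance -/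

section Table

variable (s t : List Bool)

/-- The suffix table `E i j = editDist (s.drop i) (t.drop j)` (the table `D` of Wagner–Fischer
1974, §4, taken over suffixes instead of prefixes, so that it matches the structural recursion
of `editDist`). [cite: WagnerFischerJACM1974, §4] -/
def E (i j : ℕ) : ℕ := editDist (s.drop i) (t.drop j)

/-- The suffix table in row-major linear indexing with row stride `|t| + 1`. [folklore] -/
def Elin (l : ℕ) : ℕ := E s t (l / (t.length + 1)) (l % (t.length + 1))

/-- The input words `encodeBoolPair (s, t)` as a total function (default `0`). [folklore] -/
def xv (r : ℕ) : ℕ := (encodeBoolPair (s, t)).getD r 0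

/-- Table entries are at most `|s| + |t| + 1`. [folklore] -/
theorem E_le (i j : ℕ) : E s t i j ≤ s.length + t.length + 1 := by
  unfold E
  have := editDist_le_max_length (s.drop i) (t.drop j)
  simp only [List.length_drop] at this
  omega

/-- Table entries are at most `|s| + |t| + 1` (linear indexing). [folklore] -/
theorem Elin_le (l : ℕ) : Elin s t l ≤ s.length + t.length + 1 := E_le s t _ _

/-- Linear index `i (|t| + 1) + j` is entry `(i, j)`. [folklore] -/
theorem Elin_eq {i j : ℕ} (hj : j ≤ t.length) : Elin s t (i * (t.length + 1) + j) = E s t i j := by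
  unfold Elin
  have hW : 0 < t.length + 1 := Nat.succ_pos _
  rw [Nat.add_comm, Nat.add_mul_div_right _ _ hW, Nat.div_eq_of_lt (Nat.lt_succ_of_le hj),
    Nat.zero_add, Nat.add_mul_mod_self_right, Nat.mod_eq_of_lt (Nat.lt_succ_of_le hj)]

/-- Entry `0` is the edit distance. [folklore] -/
theorem Elin_zero : Elin s t 0 = editDist s t := by
  simp [Elin, E]

/-- Last row: `E |s| j = |t| - j` (Wagner–Fischer 1974, Thm 3, for suffixes).
[cite: WagnerFischerJACM1974, Theorem 3] -/
theorem Elin_lastRow {c v : ℕ} (h : c + v = t.length) :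
    Elin s t (s.length * (t.length + 1) + c) = v := by
  rw [Elin_eq s t (by omega)]
  simp [E, h.symm]

/-- Last column: `E i |t| = E (i + 1) |t| + 1` for `i < |s|` (Wagner–Fischer 1974, Thm 3, for
suffixes). [cite: WagnerFischerJACM1974, Theorem 3] -/
theorem Elin_lastCol {i : ℕ} (hi : i < s.length) :
    Elin s t (i * (t.length + 1) + t.length) =
      Elin s t (i * (t.length + 1) + (t.length + 1) + t.length) + 1 := by
  rw [show i * (t.length + 1) + (t.length + 1) = (i + 1) * (t.length + 1) by ring]
  rw [Elin_eq s t le_rfl, Elin_eq s t le_rfl]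
  simp [E]
  omega

/-- Input word `1 + i` is the bit `s[i]`. [folklore] -/
theorem xv_succ {i : ℕ} (hi : i < s.length) : xv s t (1 + i) = (s[i]).toNat := by
  unfold xv encodeBoolPair
  rw [Nat.add_comm, List.getD_cons_succ, List.getD_eq_getElem _ _ (by simp; omega),
    List.getElem_map, List.getElem_append_left (by simpa using hi)]

/-- Input word `1 + |s| + j` is the bit `t[j]`. [folklore] -/
theorem xv_succ_add {j : ℕ} (hj : j < t.length) : xv s t (1 + s.length + j) = (t[j]).toNat := by
  unfold xv encodeBoolPair
  rw [show 1 + s.length + j = (s.length + j) + 1 by omega, List.getD_cons_succ,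
    List.getD_eq_getElem _ _ (by simp; omega)]
  simp

/-- Input word `0` is `|s|`. [folklore] -/
theorem xv_zero : xv s t 0 = s.length := by
  simp [xv, encodeBoolPair]

/-- Input words are at most `|s| + |t| + 1`. [folklore] -/
theorem xv_le (r : ℕ) : xv s t r ≤ s.length + t.length + 1 := by
  unfold xv encodeBoolPair
  cases r with
  | zero => simp
            omega
  | succ r =>
    rw [List.getD_cons_succ]
    by_cases hr : r < ((s ++ t).map Bool.toNat).length
    · rw [List.getD_eq_getElem _ _ hr, List.getElem_map]
      exact le_trans (Bool.toNat_le _) (by omega)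
    · rw [List.getD_eq_default _ _ (not_lt.mp hr)]; omega

/-- **The Wagner–Fischer recurrence** (Wagner–Fischer 1974, Thm 2, for suffixes) in linear
indexing: `E i j = min (E i (j+1) + 1) (E (i+1) j + 1) (E (i+1) (j+1) + [sᵢ ≠ tⱼ])`.
[cite: WagnerFischerJACM1974, Theorem 2] -/
theorem Elin_rec {i j : ℕ} (hi : i < s.length) (hj : j < t.length) :
    Elin s t (i * (t.length + 1) + j) =
      min (min (Elin s t (i * (t.length + 1) + j + 1) + 1)
        (Elin s t (i * (t.length + 1) + (t.length + 1) + j) + 1))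
        (Elin s t (i * (t.length + 1) + (t.length + 1) + j + 1) +
          neWord (xv s t (1 + i)) (xv s t (1 + s.length + j))) := by
  rw [show i * (t.length + 1) + (t.length + 1) = (i + 1) * (t.length + 1) by ring]
  rw [Elin_eq s t hj.le, Nat.add_assoc, Elin_eq s t hj, Elin_eq s t hj.le, Nat.add_assoc,
    Elin_eq s t hj, xv_succ s t hi, xv_succ_add s t hj]
  unfold E
  rw [List.drop_eq_getElem_cons hi, List.drop_eq_getElem_cons hj, editDist_cons_cons]
  have : neWord (s[i]).toNat (t[j]).toNat = if s[i] = t[j] then 0 else 1 := by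
    rw [neWord_eq_ite]
    rcases s[i] <;> rcases t[j] <;> simp
  rw [this, min_left_comm, min_assoc]

end Table

/-! ## The program -/

section Program

open WordRAM.Operand BinOp WordRAM.BinOp WordRAM.Instr

/-- **The Wagner–Fischer edit-distance program** (71 instructions; registers in cells `0 … 18`).
On input `x = encodeBoolPair (s, t)` of length `L = |s| + |t| + 1` (cells `1 … L`):
* `0–9`: copy cells `1, 2, 3` to `L + 21, L + 22, L + 23` (cell `0` as pointer), set
  `L := mem 3`, counter `:= L`, source pointer `:= 4`;
* `10–15` (loop): copy cells `4 … L + 3` to `L + 24 … 2L + 23`, so that input word `x[a-1]`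
  sits at cell `L + 20 + a` for `1 ≤ a ≤ L` and cells `1 … 18` are free;
* `16–30`: registers `|s|, |t|, W = |t| + 1, T = 2L + 24` (table base), pointer to the last
  table cell, counters;
* `31–36` (loop): last row `E |s| j = |t| - j`, right to left;
* `37–67` (loop over rows `i = |s| - 1 … 0`): last column `E i |t| = E (i+1) |t| + 1`, then
  (inner loop `45–66`, `j = |t| - 1 … 0`) the recurrence, with the minimum of three computed
  branch-free (`min_gadget`) and `[sᵢ ≠ tⱼ]` as `1 - [sᵢ = tⱼ]`;
* `68–70`: output `[E 0 0] = [editDist s t]` (`mem 1 := mem T; mem 0 := 1; halt`).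
Wagner–Fischer 1974, Algorithm X, run over suffixes. [cite: WagnerFischerJACM1974, Algorithm X] -/
def prog : Program := [
  op add (dir 0) (dir 0) (imm 20),        -- 0   Q := L + 20
  op add (dir 0) (dir 0) (imm 1),         -- 1   Q += 1
  op add (ind 0) (dir 1) (imm 0),         -- 2   [Q] := x₀
  op add (dir 0) (dir 0) (imm 1),         -- 3   Q += 1
  op add (ind 0) (dir 2) (imm 0),         -- 4   [Q] := x₁
  op add (dir 0) (dir 0) (imm 1),         -- 5   Q += 1
  op add (ind 0) (dir 3) (imm 0),         -- 6   [Q] := x₂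
  op sub (dir 3) (dir 0) (imm 23),        -- 7   L := Q - 23
  op add (dir 2) (dir 3) (imm 0),         -- 8   Cnt := L
  op add (dir 1) (imm 4) (imm 0),         -- 9   P := 4
  jz (dir 2) 16,                           -- 10  reloc: while Cnt ≠ 0
  op add (dir 0) (dir 0) (imm 1),         -- 11    Q += 1
  op add (ind 0) (ind 1) (imm 0),         -- 12    [Q] := [P]
  op add (dir 1) (dir 1) (imm 1),         -- 13    P += 1
  op sub (dir 2) (dir 2) (imm 1),         -- 14    Cnt -= 1
  jmp 10,                                  -- 15
  op add (dir 8) (dir 3) (imm 21),        -- 16  Qp := L + 21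
  op add (dir 4) (ind 8) (imm 0),         -- 17  M1 := [Qp] = |s|
  op sub (dir 5) (dir 3) (imm 1),         -- 18  M2 := L - 1
  op sub (dir 5) (dir 5) (dir 4),         -- 19  M2 := |t|
  op add (dir 6) (dir 5) (imm 1),         -- 20  W := |t| + 1
  op add (dir 7) (dir 3) (dir 3),         -- 21  T := 2L
  op add (dir 7) (dir 7) (imm 24),        -- 22  T := 2L + 24
  op mul (dir 1) (dir 4) (dir 6),         -- 23  P := |s| W
  op add (dir 1) (dir 1) (dir 7),         -- 24  P := |s| W + T
  op add (dir 1) (dir 1) (dir 5),         -- 25  P := T + |s| W + |t|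
  op add (dir 18) (imm 0) (imm 0),        -- 26  V := 0
  op add (dir 2) (dir 6) (imm 0),         -- 27  Cnt := W
  op add (dir 9) (dir 4) (imm 0),         -- 28  I := |s|
  op add (dir 11) (dir 8) (dir 4),        -- 29  SI := L + 21 + |s|
  op add (dir 11) (dir 11) (imm 1),       -- 30  SI := L + 22 + |s|
  jz (dir 2) 37,                           -- 31  row: while Cnt ≠ 0
  op add (ind 1) (dir 18) (imm 0),        -- 32    [P] := V
  op add (dir 18) (dir 18) (imm 1),       -- 33    V += 1
  op sub (dir 1) (dir 1) (imm 1),         -- 34    P -= 1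
  op sub (dir 2) (dir 2) (imm 1),         -- 35    Cnt -= 1
  jmp 31,                                  -- 36
  jz (dir 9) 68,                           -- 37  outer: while I ≠ 0
  op sub (dir 9) (dir 9) (imm 1),         -- 38    I -= 1
  op sub (dir 11) (dir 11) (imm 1),       -- 39    SI -= 1
  op add (dir 8) (dir 1) (dir 6),         -- 40    Qp := P + W
  op add (ind 1) (ind 8) (imm 1),         -- 41    [P] := [Qp] + 1
  op sub (dir 1) (dir 1) (imm 1),         -- 42    P -= 1
  op add (dir 10) (dir 5) (imm 0),        -- 43    J := |t|
  op sub (dir 12) (dir 7) (imm 3),        -- 44    TJ := T - 3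
  jz (dir 10) 67,                          -- 45    inner: while J ≠ 0
  op sub (dir 10) (dir 10) (imm 1),       -- 46      J -= 1
  op sub (dir 12) (dir 12) (imm 1),       -- 47      TJ -= 1
  op add (dir 8) (dir 1) (imm 1),         -- 48      Qp := P + 1
  op add (dir 13) (ind 8) (imm 1),        -- 49      A := [Qp] + 1
  op add (dir 8) (dir 1) (dir 6),         -- 50      Qp := P + W
  op add (dir 14) (ind 8) (imm 1),        -- 51      B := [Qp] + 1
  op add (dir 8) (dir 8) (imm 1),         -- 52      Qp += 1
  op eq (dir 17) (ind 11) (ind 12),       -- 53      F := [sᵢ = tⱼ]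
  op sub (dir 17) (imm 1) (dir 17),       -- 54      F := 1 - F
  op add (dir 15) (ind 8) (dir 17),       -- 55      C := [Qp] + F
  op sub (dir 16) (dir 13) (dir 14),      -- 56      D := A - B
  op lt (dir 17) (dir 14) (dir 13),       -- 57      F := [B < A]
  op mul (dir 16) (dir 16) (dir 17),      -- 58      D := D F
  op sub (dir 13) (dir 13) (dir 16),      -- 59      A := A - D  (= min A B)
  op sub (dir 16) (dir 13) (dir 15),      -- 60      D := A - C
  op lt (dir 17) (dir 15) (dir 13),       -- 61      F := [C < A]
  op mul (dir 16) (dir 16) (dir 17),      -- 62      D := D F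
  op sub (dir 13) (dir 13) (dir 16),      -- 63      A := A - D  (= min A C)
  op add (ind 1) (dir 13) (imm 0),        -- 64      [P] := A
  op sub (dir 1) (dir 1) (imm 1),         -- 65      P -= 1
  jmp 45,                                  -- 66
  jmp 37,                                  -- 67
  op add (dir 1) (ind 7) (imm 0),         -- 68  mem 1 := [T]
  op add (dir 0) (imm 1) (imm 0),         -- 69  mem 0 := 1
  halt]                                    -- 70

/-- The program has `71` instructions. [folklore] -/
theorem prog_length : prog.length = 71 := rfl

/-- The program is deterministic (no `rand`). [folklore] -/
theorem prog_isDeterministic : prog.IsDeterministic := by decide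

/-- The program is oracle-free (no `query`). [folklore] -/
theorem prog_isOracleFree : prog.IsOracleFree := by decide

/-- Prologue block (pc `0–9`). [folklore] -/
def proBlock : List OpSpec :=
  [(add, dir 0, dir 0, imm 20), (add, dir 0, dir 0, imm 1), (add, ind 0, dir 1, imm 0),
   (add, dir 0, dir 0, imm 1), (add, ind 0, dir 2, imm 0), (add, dir 0, dir 0, imm 1),
   (add, ind 0, dir 3, imm 0), (sub, dir 3, dir 0, imm 23), (add, dir 2, dir 3, imm 0),
   (add, dir 1, imm 4, imm 0)]

/-- Relocation-loop body (pc `11–14`). [folklore] -/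
def relocBody : List OpSpec :=
  [(add, dir 0, dir 0, imm 1), (add, ind 0, ind 1, imm 0), (add, dir 1, dir 1, imm 1),
   (sub, dir 2, dir 2, imm 1)]

/-- Initialisation block (pc `16–30`). [folklore] -/
def initBlock : List OpSpec :=
  [(add, dir 8, dir 3, imm 21), (add, dir 4, ind 8, imm 0), (sub, dir 5, dir 3, imm 1),
   (sub, dir 5, dir 5, dir 4), (add, dir 6, dir 5, imm 1), (add, dir 7, dir 3, dir 3),
   (add, dir 7, dir 7, imm 24), (mul, dir 1, dir 4, dir 6), (add, dir 1, dir 1, dir 7),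
   (add, dir 1, dir 1, dir 5), (add, dir 18, imm 0, imm 0), (add, dir 2, dir 6, imm 0),
   (add, dir 9, dir 4, imm 0), (add, dir 11, dir 8, dir 4), (add, dir 11, dir 11, imm 1)]

/-- Row-loop body (pc `32–35`). [folklore] -/
def rowBody : List OpSpec :=
  [(add, ind 1, dir 18, imm 0), (add, dir 18, dir 18, imm 1), (sub, dir 1, dir 1, imm 1),
   (sub, dir 2, dir 2, imm 1)]

/-- Outer-loop body, straight-line part (pc `38–44`). [folklore] -/
def outerBlock : List OpSpec :=
  [(sub, dir 9, dir 9, imm 1), (sub, dir 11, dir 11, imm 1), (add, dir 8, dir 1, dir 6),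
   (add, ind 1, ind 8, imm 1), (sub, dir 1, dir 1, imm 1), (add, dir 10, dir 5, imm 0),
   (sub, dir 12, dir 7, imm 3)]

/-- Inner-loop body (pc `46–65`). [folklore] -/
def innerBody : List OpSpec :=
  [(sub, dir 10, dir 10, imm 1), (sub, dir 12, dir 12, imm 1), (add, dir 8, dir 1, imm 1),
   (add, dir 13, ind 8, imm 1), (add, dir 8, dir 1, dir 6), (add, dir 14, ind 8, imm 1),
   (add, dir 8, dir 8, imm 1), (eq, dir 17, ind 11, ind 12), (sub, dir 17, imm 1, dir 17),
   (add, dir 15, ind 8, dir 17), (sub, dir 16, dir 13, dir 14), (lt, dir 17, dir 14, dir 13),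
   (mul, dir 16, dir 16, dir 17), (sub, dir 13, dir 13, dir 16), (sub, dir 16, dir 13, dir 15),
   (lt, dir 17, dir 15, dir 13), (mul, dir 16, dir 16, dir 17), (sub, dir 13, dir 13, dir 16),
   (add, ind 1, dir 13, imm 0), (sub, dir 1, dir 1, imm 1)]

/-- Epilogue (pc `68–69`). [folklore] -/
def epilogue : List OpSpec :=
  [(add, dir 1, ind 7, imm 0), (add, dir 0, imm 1, imm 0)]

/-- The prologue block sits at pc `0`. [folklore] -/
theorem codeAt_proBlock : CodeAt prog 0 (proBlock.map OpSpec.toInstr) := codeAt_of_drop_take rfl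
/-- pc `10`: the relocation-loop test. [folklore] -/
theorem prog_10 : prog[10]? = some (jz (dir 2) 16) := rfl
/-- The relocation-loop body sits at pc `11`. [folklore] -/
theorem codeAt_relocBody : CodeAt prog 11 (relocBody.map OpSpec.toInstr) := codeAt_of_drop_take rfl
/-- pc `15`: jump back to the relocation-loop test. [folklore] -/
theorem prog_15 : prog[15]? = some (jmp 10) := rfl
/-- The initialisation block sits at pc `16`. [folklore] -/
theorem codeAt_initBlock : CodeAt prog 16 (initBlock.map OpSpec.toInstr) := codeAt_of_drop_take rfl
/-- pc `31`: the row-loop test. [folklore] -/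
theorem prog_31 : prog[31]? = some (jz (dir 2) 37) := rfl
/-- The row-loop body sits at pc `32`. [folklore] -/
theorem codeAt_rowBody : CodeAt prog 32 (rowBody.map OpSpec.toInstr) := codeAt_of_drop_take rfl
/-- pc `36`: jump back to the row-loop test. [folklore] -/
theorem prog_36 : prog[36]? = some (jmp 31) := rfl
/-- pc `37`: the outer-loop test. [folklore] -/
theorem prog_37 : prog[37]? = some (jz (dir 9) 68) := rfl
/-- The straight-line part of the outer-loop body sits at pc `38`. [folklore] -/
theorem codeAt_outerBlock : CodeAt prog 38 (outerBlock.map OpSpec.toInstr) :=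
  codeAt_of_drop_take rfl
/-- pc `45`: the inner-loop test. [folklore] -/
theorem prog_45 : prog[45]? = some (jz (dir 10) 67) := rfl
/-- The inner-loop body sits at pc `46`. [folklore] -/
theorem codeAt_innerBody : CodeAt prog 46 (innerBody.map OpSpec.toInstr) := codeAt_of_drop_take rfl
/-- pc `66`: jump back to the inner-loop test. [folklore] -/
theorem prog_66 : prog[66]? = some (jmp 45) := rfl
/-- pc `67`: jump back to the outer-loop test. [folklore] -/
theorem prog_67 : prog[67]? = some (jmp 37) := rfl
/-- The epilogue sits at pc `68`. [folklore] -/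
theorem codeAt_epilogue : CodeAt prog 68 (epilogue.map OpSpec.toInstr) := codeAt_of_drop_take rfl
/-- pc `70`: `halt`. [folklore] -/
theorem prog_70 : prog[70]? = some halt := rfl

end Program

/-! ## Invariants

Throughout, `m1 = |s|`, `m2 = |t|`, the input has length `L = m1 + m2 + 1`, its image starts at
cell `m1 + m2 + 22` (word `x[a-1]` at cell `m1 + m2 + 21 + a`), the table starts at cell
`T = 2 m1 + 2 m2 + 26` (entry of linear index `l` at cell `T + l`), and `N` is the number of
table entries. -/

section Machine

/-- `Function.update` read at an address provably equal to the written one. [folklore] -/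
theorem upd_eq {f : ℕ → ℕ} {a a' v : ℕ} (h : a = a') : Function.update f a' v a = v := by
  subst h; exact Function.update_self ..

/-- Image of the input: word `x[a-1]` sits at cell `m1 + m2 + 21 + a`. [folklore] -/
def Img (m1 m2 : ℕ) (xv : ℕ → ℕ) (mem : ℕ → ℕ) : Prop :=
  ∀ a, 1 ≤ a → a ≤ m1 + m2 + 1 → mem (m1 + m2 + 21 + a) = xv (a - 1)

/-- The table cells of linear index `≥ lo` (and `< N`) hold the suffix edit distances. [folklore] -/
def TableFrom (m1 m2 N : ℕ) (Elin : ℕ → ℕ) (lo : ℕ) (mem : ℕ → ℕ) : Prop :=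
  ∀ l, lo ≤ l → l < N → mem (2 * m1 + 2 * m2 + 26 + l) = Elin l

/-- The constant registers `3 … 7`: `L`, `|s|`, `|t|`, `|t| + 1`, table base `T`. [folklore] -/
structure Regs (m1 m2 : ℕ) (mem : ℕ → ℕ) : Prop where
  h3 : mem 3 = m1 + m2 + 1
  h4 : mem 4 = m1
  h5 : mem 5 = m2
  h6 : mem 6 = m2 + 1
  h7 : mem 7 = 2 * m1 + 2 * m2 + 26

/-- Relocation-loop invariant, indexed by the counter (cell `2`): source pointer `p = mem 1`
with `p + c = L + 4`, destination pointer `mem 0 = m1 + m2 + 20 + p`, image built below `p`,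
source cells `4 … L + 3` pristine. [folklore] -/
structure RelocInv (m1 m2 : ℕ) (xv : ℕ → ℕ) (c : ℕ) (mem : ℕ → ℕ) : Prop where
  h3 : mem 3 = m1 + m2 + 1
  h2 : mem 2 = c
  hc : c ≤ m1 + m2 + 1
  h1 : mem 1 + c = m1 + m2 + 5
  h0 : mem 0 + c = 2 * m1 + 2 * m2 + 25
  img : ∀ a, 1 ≤ a → a + c ≤ m1 + m2 + 4 → mem (m1 + m2 + 21 + a) = xv (a - 1)
  src : ∀ a, 4 ≤ a → a ≤ m1 + m2 + 4 → mem a = xv (a - 1)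

/-- Row-loop invariant (filling row `|s|` right to left), indexed by the counter (cell `2`).
[folklore] -/
structure RowInv (m1 m2 N : ℕ) (xv Elin : ℕ → ℕ) (c : ℕ) (mem : ℕ → ℕ) : Prop where
  regs : Regs m1 m2 mem
  h9 : mem 9 = m1
  h11 : mem 11 = 2 * m1 + m2 + 23
  h2 : mem 2 = c
  hc : c ≤ m2 + 1
  h18 : mem 18 + c = m2 + 1
  h1 : mem 1 + 1 = 2 * m1 + 2 * m2 + 26 + m1 * (m2 + 1) + c
  tab : TableFrom m1 m2 N Elin (m1 * (m2 + 1) + c) mem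
  img : Img m1 m2 xv mem

/-- Outer-loop invariant (rows `≥ i` filled), indexed by the row counter (cell `9`). [folklore] -/
structure OuterInv (m1 m2 N : ℕ) (xv Elin : ℕ → ℕ) (i : ℕ) (mem : ℕ → ℕ) : Prop where
  regs : Regs m1 m2 mem
  h9 : mem 9 = i
  h11 : mem 11 = m1 + m2 + 23 + i
  h1 : mem 1 + 1 = 2 * m1 + 2 * m2 + 26 + i * (m2 + 1)
  hi : i ≤ m1
  tab : TableFrom m1 m2 N Elin (i * (m2 + 1)) mem
  img : Img m1 m2 xv mem

/-- Inner-loop invariant (row `i`, cells of column `≥ j` filled), indexed by the column counter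
(cell `10`). [folklore] -/
structure InnerInv (m1 m2 N : ℕ) (xv Elin : ℕ → ℕ) (i j : ℕ) (mem : ℕ → ℕ) : Prop where
  regs : Regs m1 m2 mem
  h9 : mem 9 = i
  h11 : mem 11 = m1 + m2 + 23 + i
  h10 : mem 10 = j
  h12 : mem 12 = 2 * m1 + m2 + 23 + j
  h1 : mem 1 + 1 = 2 * m1 + 2 * m2 + 26 + i * (m2 + 1) + j
  hi : i < m1
  hj : j ≤ m2
  tab : TableFrom m1 m2 N Elin (i * (m2 + 1) + j) mem
  img : Img m1 m2 xv mem

/-! ## Block lemmas (symbolic execution)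

Memory facts (`mem a = v`) are kept inside structures (`Sealed`, the invariants) and fed to
`simp` as rewrite rules, so that the arithmetic side conditions (distinctness of addresses,
absence of overflow) are discharged by `decide` / `simp +arith` / `omega` in a context holding
only the few genuinely arithmetic hypotheses. -/

/-- A proposition sealed against the arithmetic deciders (`omega` does not look inside).
[folklore] -/
structure Sealed (p : Prop) : Prop where
  /-- The sealed fact. -/
  out : p

variable {w m1 m2 N : ℕ} {xv Elin : ℕ → ℕ}

/-- The inner-loop body computes one table cell by the recurrence. [folklore] -/
theorem innerBody_spec (hw : 2 * m1 + 2 * m2 + 26 + N ≤ 2 ^ w) (hN : N = m1 * (m2 + 1) + (m2 + 1))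
    (hxv : ∀ r, xv r ≤ m1 + m2 + 1) (hE : ∀ l, Elin l ≤ m1 + m2 + 1)
    (hrec : ∀ i j, i < m1 → j < m2 → Elin (i * (m2 + 1) + j) =
      min (min (Elin (i * (m2 + 1) + j + 1) + 1) (Elin (i * (m2 + 1) + (m2 + 1) + j) + 1))
        (Elin (i * (m2 + 1) + (m2 + 1) + j + 1) + neWord (xv (1 + i)) (xv (1 + m1 + j))))
    {i j : ℕ} {mem : ℕ → ℕ} (hI : InnerInv m1 m2 N xv Elin i (j + 1) mem) :
    InnerInv m1 m2 N xv Elin i j (execOps w mem innerBody) := by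
  have hi := hI.hi
  have hj := hI.hj
  have hoN : i * (m2 + 1) + (m2 + 1) + m2 < N := by
    rw [hN]; have := Nat.mul_le_mul_right (m2 + 1) (Nat.succ_le_of_lt hi); rw [Nat.succ_mul] at this
    omega
  have hA : Sealed (mem (2 * m1 + 2 * m2 + 26 + i * (m2 + 1) + j + 1) =
      Elin (i * (m2 + 1) + j + 1)) := ⟨by
    have := hI.tab (i * (m2 + 1) + j + 1) (by omega) (by omega)
    rwa [show 2 * m1 + 2 * m2 + 26 + (i * (m2 + 1) + j + 1) =
      2 * m1 + 2 * m2 + 26 + i * (m2 + 1) + j + 1 by omega] at this⟩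
  have hB : Sealed (mem (2 * m1 + 2 * m2 + 26 + i * (m2 + 1) + j + (m2 + 1)) =
      Elin (i * (m2 + 1) + (m2 + 1) + j)) := ⟨by
    have := hI.tab (i * (m2 + 1) + (m2 + 1) + j) (by omega) (by omega)
    rwa [show 2 * m1 + 2 * m2 + 26 + (i * (m2 + 1) + (m2 + 1) + j) =
      2 * m1 + 2 * m2 + 26 + i * (m2 + 1) + j + (m2 + 1) by omega] at this⟩
  have hC : Sealed (mem (2 * m1 + 2 * m2 + 26 + i * (m2 + 1) + j + (m2 + 1) + 1) =
      Elin (i * (m2 + 1) + (m2 + 1) + j + 1)) := ⟨by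
    have := hI.tab (i * (m2 + 1) + (m2 + 1) + j + 1) (by omega) (by omega)
    rwa [show 2 * m1 + 2 * m2 + 26 + (i * (m2 + 1) + (m2 + 1) + j + 1) =
      2 * m1 + 2 * m2 + 26 + i * (m2 + 1) + j + (m2 + 1) + 1 by omega] at this⟩
  have hs : Sealed (mem (m1 + m2 + 23 + i) = xv (1 + i)) := ⟨by
    have := hI.img (2 + i) (by omega) (by omega)
    rwa [show m1 + m2 + 21 + (2 + i) = m1 + m2 + 23 + i by omega,
      show 2 + i - 1 = 1 + i by omega] at this⟩
  have ht : Sealed (mem (2 * m1 + m2 + 23 + j) = xv (1 + m1 + j)) := ⟨by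
    have := hI.img (2 + m1 + j) (by omega) (by omega)
    rwa [show m1 + m2 + 21 + (2 + m1 + j) = 2 * m1 + m2 + 23 + j by omega,
      show 2 + m1 + j - 1 = 1 + m1 + j by omega] at this⟩
  have eA := hE (i * (m2 + 1) + j + 1)
  have eB := hE (i * (m2 + 1) + (m2 + 1) + j)
  have eC := hE (i * (m2 + 1) + (m2 + 1) + j + 1)
  have exs := hxv (1 + i)
  have ext := hxv (1 + m1 + j)
  have hnq := neWord_le_one (xv (1 + i)) (xv (1 + m1 + j))
  have h1' : Sealed (mem 1 = 2 * m1 + 2 * m2 + 26 + i * (m2 + 1) + j) := ⟨by have := hI.h1; omega⟩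
  have hs10 : BinOp.sub.eval w (j + 1) 1 = j := by
    have := BinOp.eval_sub_of_le (w := w) (x := j + 1) (y := 1) (by omega) (by omega); omega
  have hs12 : BinOp.sub.eval w (2 * m1 + m2 + 23 + (j + 1)) 1 = 2 * m1 + m2 + 23 + j := by
    have := BinOp.eval_sub_of_le (w := w) (x := 2 * m1 + m2 + 23 + (j + 1)) (y := 1) (by omega)
      (by omega); omega
  have hsP : BinOp.sub.eval w (2 * m1 + 2 * m2 + 26 + i * (m2 + 1) + j) 1 =
      2 * m1 + 2 * m2 + 25 + i * (m2 + 1) + j := by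
    have := BinOp.eval_sub_of_le (w := w) (x := 2 * m1 + 2 * m2 + 26 + i * (m2 + 1) + j) (y := 1)
      (by omega) (by omega); omega
  have hw1 : 1 < 2 ^ w := by omega
  have hrec' := hrec i j hi (by omega)
  clear hrec hE hxv
  unfold innerBody
  iterate 20
    rw [execOps_cons]
    (first | rw [execOp_dir] | rw [execOp_ind])
    simp (disch := first | decide | (simp +arith; done) | omega) only [Operand.read_dir,
      Operand.read_ind, Operand.read_imm,
      Function.update_self, Function.update_of_ne, hI.regs.h6, hI.h11, hI.h10, hI.h12, h1'.out,
      hA.out, hB.out, hC.out, hs.out, ht.out, hs10, hs12, hsP, BinOp.eval_add_of_lt,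
      BinOp.ne_gadget hw1, BinOp.min_gadget, Nat.add_zero]
  rw [execOps_nil]
  refine ⟨⟨?_, ?_, ?_, ?_, ?_⟩, ?_, ?_, ?_, ?_, ?_, hi, by omega, ?_, ?_⟩
  iterate 9 (simp (disch := first | decide | (simp +arith; done) | omega) only
    [Function.update_self, Function.update_of_ne, hI.regs.h3, hI.regs.h4, hI.regs.h5, hI.regs.h6,
    hI.regs.h7, hI.h9, hI.h11])
  · simp only [Function.update_self]
    omega
  · intro l hl hlN
    rcases Nat.eq_or_lt_of_le hl with rfl | hl'
    · rw [Function.update_of_ne (by simp +arith), upd_eq (by simp +arith), hrec']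
    · simp (disch := first | decide | (simp +arith; done) | omega) only [Function.update_of_ne]
      exact hI.tab l (by omega) hlN
  · intro a ha1 haL
    simp (disch := first | decide | (simp +arith; done) | omega) only [Function.update_of_ne]
    exact hI.img a ha1 haL

/-- The straight-line part of the outer-loop body: last-column entry of row `i`, counters of the
inner loop. [folklore] -/
theorem outerBlock_spec (hw : 2 * m1 + 2 * m2 + 26 + N ≤ 2 ^ w) (hN : N = m1 * (m2 + 1) + (m2 + 1))
    (hE : ∀ l, Elin l ≤ m1 + m2 + 1)
    (hcol : ∀ i, i < m1 → Elin (i * (m2 + 1) + m2) = Elin (i * (m2 + 1) + (m2 + 1) + m2) + 1)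
    {i : ℕ} {mem : ℕ → ℕ} (hI : OuterInv m1 m2 N xv Elin (i + 1) mem) :
    InnerInv m1 m2 N xv Elin i m2 (execOps w mem outerBlock) := by
  have hi : i < m1 := hI.hi
  have hmul : (i + 1) * (m2 + 1) = i * (m2 + 1) + (m2 + 1) := by ring
  have hoN : i * (m2 + 1) + (m2 + 1) + m2 < N := by
    rw [hN]; have := Nat.mul_le_mul_right (m2 + 1) (Nat.succ_le_of_lt hi); rw [Nat.succ_mul] at this
    omega
  have h1' : Sealed (mem 1 = 2 * m1 + 2 * m2 + 26 + i * (m2 + 1) + m2) := ⟨by have := hI.h1; omega⟩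
  have hQ : Sealed (mem (2 * m1 + 2 * m2 + 26 + i * (m2 + 1) + m2 + (m2 + 1)) =
      Elin (i * (m2 + 1) + (m2 + 1) + m2)) := ⟨by
    have := hI.tab (i * (m2 + 1) + (m2 + 1) + m2) (by omega) (by omega)
    rwa [show 2 * m1 + 2 * m2 + 26 + (i * (m2 + 1) + (m2 + 1) + m2) =
      2 * m1 + 2 * m2 + 26 + i * (m2 + 1) + m2 + (m2 + 1) by omega] at this⟩
  have eQ := hE (i * (m2 + 1) + (m2 + 1) + m2)
  have hs9 : BinOp.sub.eval w (i + 1) 1 = i := by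
    have := BinOp.eval_sub_of_le (w := w) (x := i + 1) (y := 1) (by omega) (by omega); omega
  have hs11 : BinOp.sub.eval w (m1 + m2 + 23 + (i + 1)) 1 = m1 + m2 + 23 + i := by
    have := BinOp.eval_sub_of_le (w := w) (x := m1 + m2 + 23 + (i + 1)) (y := 1) (by omega)
      (by omega); omega
  have hsP : BinOp.sub.eval w (2 * m1 + 2 * m2 + 26 + i * (m2 + 1) + m2) 1 =
      2 * m1 + 2 * m2 + 25 + i * (m2 + 1) + m2 := by
    have := BinOp.eval_sub_of_le (w := w) (x := 2 * m1 + 2 * m2 + 26 + i * (m2 + 1) + m2) (y := 1)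
      (by omega) (by omega); omega
  have hsT : BinOp.sub.eval w (2 * m1 + 2 * m2 + 26) 3 = 2 * m1 + 2 * m2 + 23 := by
    have := BinOp.eval_sub_of_le (w := w) (x := 2 * m1 + 2 * m2 + 26) (y := 3) (by omega)
      (by omega); omega
  have hcol' := hcol i hi
  clear hcol hE
  unfold outerBlock
  iterate 7
    rw [execOps_cons]
    (first | rw [execOp_dir] | rw [execOp_ind])
    simp (disch := first | decide | (simp +arith; done) | omega) only [Operand.read_dir,
      Operand.read_ind, Operand.read_imm,
      Function.update_self, Function.update_of_ne, hI.regs.h5, hI.regs.h6, hI.regs.h7, hI.h9,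
      hI.h11, h1'.out, hQ.out, hs9, hs11, hsP, hsT, BinOp.eval_add_of_lt, Nat.add_zero]
  rw [execOps_nil]
  refine ⟨⟨?_, ?_, ?_, ?_, ?_⟩, ?_, ?_, ?_, ?_, ?_, hi, le_rfl, ?_, ?_⟩
  iterate 10 (simp (disch := first | decide | (simp +arith; done) | omega) only
    [Function.update_self, Function.update_of_ne, hI.regs.h3, hI.regs.h4, hI.regs.h5, hI.regs.h6,
    hI.regs.h7]; try omega)
  · intro l hl hlN
    rcases Nat.eq_or_lt_of_le hl with rfl | hl'
    · simp (disch := first | decide | (simp +arith; done) | omega) only [Function.update_of_ne,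
        upd_eq]
      rw [hcol']
    · simp (disch := first | decide | (simp +arith; done) | omega) only [Function.update_of_ne]
      exact hI.tab l (by omega) hlN
  · intro a ha1 haL
    simp (disch := first | decide | (simp +arith; done) | omega) only [Function.update_of_ne]
    exact hI.img a ha1 haL

/-- The row-loop body writes one entry `E |s| j = |t| - j` of the last row. [folklore] -/
theorem rowBody_spec (hw : 2 * m1 + 2 * m2 + 26 + N ≤ 2 ^ w) (hN : N = m1 * (m2 + 1) + (m2 + 1))
    (hrow : ∀ c v, c + v = m2 → Elin (m1 * (m2 + 1) + c) = v)
    {c : ℕ} {mem : ℕ → ℕ} (hI : RowInv m1 m2 N xv Elin (c + 1) mem) :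
    RowInv m1 m2 N xv Elin c (execOps w mem rowBody) := by
  have hc := hI.hc
  have h18 := hI.h18
  have h1' : Sealed (mem 1 = 2 * m1 + 2 * m2 + 26 + m1 * (m2 + 1) + c) := ⟨by have := hI.h1; omega⟩
  have hs2 : BinOp.sub.eval w (c + 1) 1 = c := by
    have := BinOp.eval_sub_of_le (w := w) (x := c + 1) (y := 1) (by omega) (by omega); omega
  have hsP : BinOp.sub.eval w (2 * m1 + 2 * m2 + 26 + m1 * (m2 + 1) + c) 1 =
      2 * m1 + 2 * m2 + 25 + m1 * (m2 + 1) + c := by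
    have := BinOp.eval_sub_of_le (w := w) (x := 2 * m1 + 2 * m2 + 26 + m1 * (m2 + 1) + c) (y := 1)
      (by omega) (by omega); omega
  have hrow' := hrow c (mem 18) (by omega)
  clear hrow
  unfold rowBody
  iterate 4
    rw [execOps_cons]
    (first | rw [execOp_dir] | rw [execOp_ind])
    simp (disch := first | decide | (simp +arith; done) | omega) only [Operand.read_dir,
      Operand.read_imm, Function.update_of_ne, hI.h2,
        h1'.out, hs2, hsP, BinOp.eval_add_of_lt, Nat.add_zero]
  rw [execOps_nil]
  refine ⟨⟨?_, ?_, ?_, ?_, ?_⟩, ?_, ?_, ?_, by omega, ?_, ?_, ?_, ?_⟩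
  iterate 10 (simp (disch := first | decide | (simp +arith; done) | omega) only
    [Function.update_self, Function.update_of_ne, hI.regs.h3, hI.regs.h4, hI.regs.h5, hI.regs.h6,
    hI.regs.h7, hI.h9, hI.h11]; try omega)
  · intro l hl hlN
    rcases Nat.eq_or_lt_of_le hl with rfl | hl'
    · simp (disch := first | decide | (simp +arith; done) | omega) only [Function.update_of_ne,
        upd_eq]
      exact hrow'.symm
    · simp (disch := first | decide | (simp +arith; done) | omega) only [Function.update_of_ne]
      exact hI.tab l (by omega) hlN
  · intro a ha1 haL
    simp (disch := first | decide | (simp +arith; done) | omega) only [Function.update_of_ne]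
    exact hI.img a ha1 haL

/-- The relocation-loop body copies one input word to the image. [folklore] -/
theorem relocBody_spec (hw : 2 * m1 + 2 * m2 + 26 + N ≤ 2 ^ w) (hxv : ∀ r, xv r ≤ m1 + m2 + 1)
    {c : ℕ} {mem : ℕ → ℕ} (hI : RelocInv m1 m2 xv (c + 1) mem) :
    RelocInv m1 m2 xv c (execOps w mem relocBody) := by
  have hc := hI.hc
  have h1 := hI.h1
  have h0 := hI.h0
  have hsrc : Sealed (mem (mem 1) = xv (mem 1 - 1)) := ⟨hI.src (mem 1) (by omega) (by omega)⟩
  have hx := hxv (mem 1 - 1)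
  have hs2 : BinOp.sub.eval w (c + 1) 1 = c := by
    have := BinOp.eval_sub_of_le (w := w) (x := c + 1) (y := 1) (by omega) (by omega); omega
  clear hxv
  unfold relocBody
  iterate 4
    rw [execOps_cons]
    (first | rw [execOp_dir] | rw [execOp_ind])
    simp (disch := first | decide | (simp +arith; done) | omega) only [Operand.read_dir,
      Operand.read_ind, Operand.read_imm,
      Function.update_self, Function.update_of_ne, hI.h2, hsrc.out, hs2, BinOp.eval_add_of_lt,
      Nat.add_zero]
  rw [execOps_nil]
  refine ⟨?_, ?_, by omega, ?_, ?_, ?_, ?_⟩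
  · simp (disch := first | decide | (simp +arith; done) | omega) only [Function.update_of_ne]
    exact hI.h3
  · simp only [Function.update_self]
  · simp (disch := first | decide | (simp +arith; done) | omega) only [Function.update_self,
      Function.update_of_ne]
    omega
  · simp (disch := first | decide | (simp +arith; done) | omega) only [Function.update_self,
      Function.update_of_ne]
    omega
  · intro a ha1 hac
    rcases Nat.eq_or_lt_of_le hac with heq | hlt
    · simp (disch := first | decide | (simp +arith; done) | omega) only [Function.update_of_ne,
        upd_eq]
      congr 1; omega
    · simp (disch := first | decide | (simp +arith; done) | omega) only [Function.update_of_ne]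
      exact hI.img a ha1 (by omega)
  · intro a ha4 haL
    simp (disch := first | decide | (simp +arith; done) | omega) only [Function.update_of_ne]
    exact hI.src a ha4 haL

/-- The initialisation block sets up the registers and the row-loop counters. [folklore] -/
theorem initBlock_spec (hw : 2 * m1 + 2 * m2 + 26 + N ≤ 2 ^ w) (hN : N = m1 * (m2 + 1) + (m2 + 1))
    (hx0 : xv 0 = m1) {mem : ℕ → ℕ} (hI : RelocInv m1 m2 xv 0 mem) :
    RowInv m1 m2 N xv Elin (m2 + 1) (execOps w mem initBlock) := by
  have hQ : Sealed (mem (m1 + m2 + 1 + 21) = m1) := ⟨by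
    have := hI.img 1 le_rfl (by omega)
    rw [show m1 + m2 + 21 + 1 = m1 + m2 + 1 + 21 by omega] at this
    exact this.trans hx0⟩
  have hsL : BinOp.sub.eval w (m1 + m2 + 1) 1 = m1 + m2 := by
    have := BinOp.eval_sub_of_le (w := w) (x := m1 + m2 + 1) (y := 1) (by omega) (by omega); omega
  have hsM : BinOp.sub.eval w (m1 + m2) m1 = m2 := by
    have := BinOp.eval_sub_of_le (w := w) (x := m1 + m2) (y := m1) (by omega) (by omega); omega
  have hNw : m1 * (m2 + 1) + (m2 + 1) < 2 ^ w := by omega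
  unfold initBlock
  iterate 15
    rw [execOps_cons, execOp_dir]
    simp (disch := first | decide | (simp +arith; done) | omega) only [Operand.read_dir,
      Operand.read_ind, Operand.read_imm, Function.update_self,
      Function.update_of_ne, hI.h3, hQ.out, hsL, hsM, BinOp.eval_add_of_lt, BinOp.eval_mul_of_lt,
      Nat.add_zero]
  rw [execOps_nil]
  refine ⟨⟨?_, ?_, ?_, ?_, ?_⟩, ?_, ?_, ?_, le_rfl, ?_, ?_, ?_, ?_⟩
  iterate 10 (simp (disch := first | decide | (simp +arith; done) | omega) only
    [Function.update_self, Function.update_of_ne, hI.h3]; try omega)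
  · intro l hl hlN
    exfalso; omega
  · intro a ha1 haL
    simp (disch := first | decide | (simp +arith; done) | omega) only [Function.update_of_ne]
    exact hI.img a ha1 (by omega)

/-- The prologue saves the first three input words above the input and sets up the relocation
loop. [folklore] -/
theorem proBlock_spec (hw : 2 * m1 + 2 * m2 + 26 + N ≤ 2 ^ w) (hxv : ∀ r, xv r ≤ m1 + m2 + 1)
    {mem : ℕ → ℕ} (hm0 : mem 0 = m1 + m2 + 1) (hmem : ∀ a, 1 ≤ a → mem a = xv (a - 1)) :
    RelocInv m1 m2 xv (m1 + m2 + 1) (execOps w mem proBlock) := by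
  have h0 : Sealed (mem 0 = m1 + m2 + 1) := ⟨hm0⟩
  have hx1 : Sealed (mem 1 = xv 0) := ⟨hmem 1 le_rfl⟩
  have hx2 : Sealed (mem 2 = xv 1) := ⟨hmem 2 (by decide)⟩
  have hx3 : Sealed (mem 3 = xv 2) := ⟨hmem 3 (by decide)⟩
  have b0 := hxv 0
  have b1 := hxv 1
  have b2 := hxv 2
  have hs3 : BinOp.sub.eval w (m1 + m2 + 1 + 20 + 1 + 1 + 1) 23 = m1 + m2 + 1 := by
    have := BinOp.eval_sub_of_le (w := w) (x := m1 + m2 + 1 + 20 + 1 + 1 + 1) (y := 23) (by omega)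
      (by omega); omega
  clear hxv hm0
  unfold proBlock
  iterate 10
    rw [execOps_cons]
    (first | rw [execOp_dir] | rw [execOp_ind])
    simp (disch := first | decide | (simp +arith; done) | omega) only [Operand.read_dir,
      Operand.read_imm, Function.update_self,
      Function.update_of_ne, h0.out, hx1.out, hx2.out, hx3.out, hs3, BinOp.eval_add_of_lt,
      Nat.add_zero]
  rw [execOps_nil]
  refine ⟨?_, ?_, le_rfl, ?_, ?_, ?_, ?_⟩
  iterate 4 (simp (disch := first | decide | (simp +arith; done) | omega) only
    [Function.update_self, Function.update_of_ne]; try omega)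
  · intro a ha1 hac
    have ha : a = 1 ∨ a = 2 ∨ a = 3 := by omega
    rcases ha with rfl | rfl | rfl <;>
    simp (disch := first | decide | (simp +arith; done) | omega) only [Function.update_of_ne,
        upd_eq, Nat.reduceSub]
  · intro a ha4 haL
    simp (disch := first | decide | (simp +arith; done) | omega) only [Function.update_of_ne]
    exact hmem a (by omega)

/-- The epilogue outputs the table entry of index `0`. [folklore] -/
theorem epilogue_spec (hw : 2 * m1 + 2 * m2 + 26 + N ≤ 2 ^ w) (hN : N = m1 * (m2 + 1) + (m2 + 1))
    (hE : ∀ l, Elin l ≤ m1 + m2 + 1) {mem : ℕ → ℕ} (hI : OuterInv m1 m2 N xv Elin 0 mem) :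
    readOut (execOps w mem epilogue) = [Elin 0] := by
  have hT : Sealed (mem (2 * m1 + 2 * m2 + 26) = Elin 0) := ⟨by
    have := hI.tab 0 (by simp) (by omega)
    rwa [Nat.add_zero] at this⟩
  have e0 := hE 0
  unfold epilogue
  iterate 2
    rw [execOps_cons, execOp_dir]
    simp (disch := first | decide | (simp +arith; done) | omega) only [Operand.read_ind,
      Operand.read_imm, hI.regs.h7, hT.out, BinOp.eval_add_of_lt,
      Nat.add_zero]
  rw [execOps_nil]
  rw [readOut_eq_singleton (by simp)]
  simp

/-- At the end of a row the inner-loop invariant is the outer-loop invariant of that row.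
[folklore] -/
theorem InnerInv.toOuter {i : ℕ} {mem : ℕ → ℕ} (hI : InnerInv m1 m2 N xv Elin i 0 mem) :
    OuterInv m1 m2 N xv Elin i mem where
  regs := hI.regs
  h9 := hI.h9
  h11 := hI.h11
  h1 := by have := hI.h1; omega
  hi := hI.hi.le
  tab := by have := hI.tab; rwa [Nat.add_zero] at this
  img := hI.img

/-- After the last row is filled, the outer-loop invariant holds for row `|s|`. [folklore] -/
theorem RowInv.toOuter {mem : ℕ → ℕ} (hI : RowInv m1 m2 N xv Elin 0 mem) :
    OuterInv m1 m2 N xv Elin m1 mem where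
  regs := hI.regs
  h9 := hI.h9
  h11 := by rw [hI.h11]; omega
  h1 := by have := hI.h1; omega
  hi := le_rfl
  tab := by have := hI.tab; rwa [Nat.add_zero] at this
  img := hI.img

end Machine

/-! ## Loops and the whole run -/

section Run

variable {w m1 m2 N : ℕ} {xv Elin : ℕ → ℕ} {O : List ℕ → List ℕ} {ρ : ℕ → ℕ}

/-- The relocation loop (pc `10`, exit `16`): `6 c + 1` steps from counter `c`. [folklore] -/
theorem relocLoop_run (hw : 2 * m1 + 2 * m2 + 26 + N ≤ 2 ^ w) (hxv : ∀ r, xv r ≤ m1 + m2 + 1)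
    {c : ℕ} {mem : ℕ → ℕ} (hI : RelocInv m1 m2 xv c mem) (cp : ℕ) (q : List (List ℕ)) :
    ∃ mem', run prog w O ρ (c * (4 + 2) + 1) ⟨some 10, mem, cp, q⟩ = some ⟨some 16, mem', cp, q⟩ ∧
      RelocInv m1 m2 xv 0 mem' :=
  run_while prog_10 prog_15 (RelocInv m1 m2 xv) (fun _ _ h => h.h2)
    (fun _ mem h => ⟨_, run_ops_mk relocBody codeAt_relocBody mem cp q, relocBody_spec hw hxv h⟩)
    c mem hI

/-- The row loop (pc `31`, exit `37`): `6 c + 1` steps from counter `c`. [folklore] -/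
theorem rowLoop_run (hw : 2 * m1 + 2 * m2 + 26 + N ≤ 2 ^ w) (hN : N = m1 * (m2 + 1) + (m2 + 1))
    (hrow : ∀ c v, c + v = m2 → Elin (m1 * (m2 + 1) + c) = v)
    {c : ℕ} {mem : ℕ → ℕ} (hI : RowInv m1 m2 N xv Elin c mem) (cp : ℕ) (q : List (List ℕ)) :
    ∃ mem', run prog w O ρ (c * (4 + 2) + 1) ⟨some 31, mem, cp, q⟩ = some ⟨some 37, mem', cp, q⟩ ∧
      RowInv m1 m2 N xv Elin 0 mem' :=
  run_while prog_31 prog_36 (RowInv m1 m2 N xv Elin) (fun _ _ h => h.h2)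
    (fun _ mem h => ⟨_, run_ops_mk rowBody codeAt_rowBody mem cp q, rowBody_spec hw hN hrow h⟩)
    c mem hI

/-- The inner loop (pc `45`, exit `67`): `22 j + 1` steps from counter `j`. [folklore] -/
theorem innerLoop_run (hw : 2 * m1 + 2 * m2 + 26 + N ≤ 2 ^ w) (hN : N = m1 * (m2 + 1) + (m2 + 1))
    (hxv : ∀ r, xv r ≤ m1 + m2 + 1) (hE : ∀ l, Elin l ≤ m1 + m2 + 1)
    (hrec : ∀ i j, i < m1 → j < m2 → Elin (i * (m2 + 1) + j) =
      min (min (Elin (i * (m2 + 1) + j + 1) + 1) (Elin (i * (m2 + 1) + (m2 + 1) + j) + 1))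
        (Elin (i * (m2 + 1) + (m2 + 1) + j + 1) + neWord (xv (1 + i)) (xv (1 + m1 + j))))
    {i j : ℕ} {mem : ℕ → ℕ} (hI : InnerInv m1 m2 N xv Elin i j mem) (cp : ℕ) (q : List (List ℕ)) :
    ∃ mem', run prog w O ρ (j * (20 + 2) + 1) ⟨some 45, mem, cp, q⟩ =
      some ⟨some 67, mem', cp, q⟩ ∧ InnerInv m1 m2 N xv Elin i 0 mem' :=
  run_while prog_45 prog_66 (InnerInv m1 m2 N xv Elin i) (fun _ _ h => h.h10)
    (fun _ mem h => ⟨_, run_ops_mk innerBody codeAt_innerBody mem cp q,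
      innerBody_spec hw hN hxv hE hrec h⟩)
    j mem hI

/-- The outer loop (pc `37`, exit `68`): `(22 |t| + 10) i + 1` steps from row counter `i`.
[folklore] -/
theorem outerLoop_run (hw : 2 * m1 + 2 * m2 + 26 + N ≤ 2 ^ w) (hN : N = m1 * (m2 + 1) + (m2 + 1))
    (hxv : ∀ r, xv r ≤ m1 + m2 + 1) (hE : ∀ l, Elin l ≤ m1 + m2 + 1)
    (hcol : ∀ i, i < m1 → Elin (i * (m2 + 1) + m2) = Elin (i * (m2 + 1) + (m2 + 1) + m2) + 1)
    (hrec : ∀ i j, i < m1 → j < m2 → Elin (i * (m2 + 1) + j) =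
      min (min (Elin (i * (m2 + 1) + j + 1) + 1) (Elin (i * (m2 + 1) + (m2 + 1) + j) + 1))
        (Elin (i * (m2 + 1) + (m2 + 1) + j + 1) + neWord (xv (1 + i)) (xv (1 + m1 + j))))
    {i : ℕ} {mem : ℕ → ℕ} (hI : OuterInv m1 m2 N xv Elin i mem) (cp : ℕ) (q : List (List ℕ)) :
    ∃ mem', run prog w O ρ (i * ((7 + (m2 * (20 + 2) + 1)) + 2) + 1) ⟨some 37, mem, cp, q⟩ =
      some ⟨some 68, mem', cp, q⟩ ∧ OuterInv m1 m2 N xv Elin 0 mem' := by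
  refine run_while prog_37 prog_67 (OuterInv m1 m2 N xv Elin) (fun _ _ h => h.h9) ?_ i mem hI
  intro i mem h
  have h1 := run_ops_mk (P := prog) (w := w) (O := O) (ρ := ρ) outerBlock codeAt_outerBlock mem cp q
  obtain ⟨mem', h2, hI'⟩ := innerLoop_run (O := O) (ρ := ρ) hw hN hxv hE hrec
    (outerBlock_spec hw hN hE hcol h) cp q
  exact ⟨mem', run_trans h1 h2 rfl, hI'.toOuter⟩

/-- **Semantics of the program.** From program counter `0` and a memory holding `L = |s|+|t|+1`
in cell `0` and the input words from cell `1` on, the program halts after exactly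
`22 |s| |t| + 16 |s| + 12 |t| + 43` steps with output `[E 0 0]`. [folklore] -/
theorem prog_run (hw : 2 * m1 + 2 * m2 + 26 + N ≤ 2 ^ w) (hN : N = m1 * (m2 + 1) + (m2 + 1))
    (hxv : ∀ r, xv r ≤ m1 + m2 + 1) (hE : ∀ l, Elin l ≤ m1 + m2 + 1) (hx0 : xv 0 = m1)
    (hrow : ∀ c v, c + v = m2 → Elin (m1 * (m2 + 1) + c) = v)
    (hcol : ∀ i, i < m1 → Elin (i * (m2 + 1) + m2) = Elin (i * (m2 + 1) + (m2 + 1) + m2) + 1)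
    (hrec : ∀ i j, i < m1 → j < m2 → Elin (i * (m2 + 1) + j) =
      min (min (Elin (i * (m2 + 1) + j + 1) + 1) (Elin (i * (m2 + 1) + (m2 + 1) + j) + 1))
        (Elin (i * (m2 + 1) + (m2 + 1) + j + 1) + neWord (xv (1 + i)) (xv (1 + m1 + j))))
    {mem : ℕ → ℕ} (hm0 : mem 0 = m1 + m2 + 1) (hmem : ∀ a, 1 ≤ a → mem a = xv (a - 1))
    (cp : ℕ) (q : List (List ℕ)) :
    ∃ mem', run prog w O ρ (22 * m1 * m2 + 16 * m1 + 12 * m2 + 43) ⟨some 0, mem, cp, q⟩ =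
      some ⟨none, mem', cp, q⟩ ∧ readOut mem' = [Elin 0] := by
  have h1 := run_ops_mk (P := prog) (w := w) (O := O) (ρ := ρ) proBlock codeAt_proBlock mem cp q
  obtain ⟨mem2, h2, I2⟩ :=
    relocLoop_run (O := O) (ρ := ρ) hw hxv (proBlock_spec (N := N) hw hxv hm0 hmem) cp q
  have h3 := run_ops_mk (P := prog) (w := w) (O := O) (ρ := ρ) initBlock codeAt_initBlock mem2 cp q
  obtain ⟨mem4, h4, I4⟩ :=
    rowLoop_run (O := O) (ρ := ρ) hw hN hrow (initBlock_spec (Elin := Elin) hw hN hx0 I2) cp q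
  obtain ⟨mem5, h5, I5⟩ := outerLoop_run (O := O) (ρ := ρ) hw hN hxv hE hcol hrec I4.toOuter cp q
  have h6 := run_ops_mk (P := prog) (w := w) (O := O) (ρ := ρ) epilogue codeAt_epilogue mem5 cp q
  have h7 := run_halt (P := prog) (w := w) (O := O) (ρ := ρ) prog_70 (execOps w mem5 epilogue) cp q
  refine ⟨_, ?_, epilogue_spec hw hN hE I5⟩
  refine run_trans h1 (run_trans h2 (run_trans h3 (run_trans h4 (run_trans h5 (run_trans h6 h7
    rfl) rfl) rfl) rfl) rfl) ?_
  simp only [proBlock, initBlock, epilogue, List.length_cons, List.length_nil]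
  ring

end Run

/-! ## The theorem -/

/-- **Word size.** With `w = 8 · inputWidth x`, every address and value of the run fits in a
word: `2|s| + 2|t| + 26 + (|s|+1)(|t|+1) ≤ 2 ^ w`. [folklore] -/
theorem wordBound (s t : List Bool) :
    2 * s.length + 2 * t.length + 26 + (s.length * (t.length + 1) + (t.length + 1)) ≤
      2 ^ (8 * inputWidth (encodeBoolPair (s, t))) := by
  set m1 := s.length
  set m2 := t.length
  have hlen : (encodeBoolPair (s, t)).length = m1 + m2 + 1 := by
    simp [encodeBoolPair, m1, m2, Nat.add_assoc]
  have hu : m1 + m2 + 2 ≤ 2 ^ inputWidth (encodeBoolPair (s, t)) := by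
    have := length_lt_two_pow_inputWidth (encodeBoolPair (s, t)); omega
  set u := m1 + m2 + 2 with hu_def
  have h2u : 2 ≤ u := by omega
  have hsq : 2 * u ≤ u * u := Nat.mul_le_mul_right u h2u
  have hN : m1 * (m2 + 1) + (m2 + 1) ≤ u * u := by
    have : m1 * (m2 + 1) + (m2 + 1) = (m1 + 1) * (m2 + 1) := by ring
    rw [this]; exact Nat.mul_le_mul (by omega) (by omega)
  have h6 : 64 ≤ u ^ 6 := by
    calc (64 : ℕ) = 2 ^ 6 := by norm_num
      _ ≤ u ^ 6 := Nat.pow_le_pow_left h2u 6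
  calc 2 * m1 + 2 * m2 + 26 + (m1 * (m2 + 1) + (m2 + 1)) ≤ 64 * (u * u) := by omega
    _ ≤ u ^ 6 * (u * u) := Nat.mul_le_mul_right _ h6
    _ = u ^ 8 := by ring
    _ ≤ (2 ^ inputWidth (encodeBoolPair (s, t))) ^ 8 := Nat.pow_le_pow_left hu 8
    _ = 2 ^ (8 * inputWidth (encodeBoolPair (s, t))) := by rw [← pow_mul, Nat.mul_comm]

/-- **Time bound.** The step count is at most `100 n² + 100`, `n = |s| + |t|`. [folklore] -/
theorem steps_le (m1 m2 : ℕ) :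
    22 * m1 * m2 + 16 * m1 + 12 * m2 + 43 ≤ 100 * (m1 + m2) ^ 2 + 100 := by
  have h1 : m1 * m2 ≤ (m1 + m2) ^ 2 := by nlinarith [Nat.zero_le m1, Nat.zero_le m2]
  have h2 : m1 + m2 ≤ (m1 + m2) ^ 2 := Nat.le_self_pow two_ne_zero _
  nlinarith [h1, h2]

end Literature.Computability.Cryptography.WagnerFischer

namespace Literature.Computability.Cryptography

open WordRAM WagnerFischer

/-- **Wagner–Fischer** (J. ACM 21 (1974), §4: Theorems 2–3 and Algorithm X, whose running time
is `O(|A|·|B|)` — "the number of assignments is exactly `1 + |A| + |B| + 4|A||B|`", p. 172):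
edit distance of bit strings of total length `n` is computable in `O(n²)` time on the word RAM.
Witness: the program `WagnerFischer.prog` with word-size constant `k = 8`, halting after
`22|s||t| + 16|s| + 12|t| + 43 ≤ 100 n² + 100` steps with output `[editDist s t]`.
[cite: WagnerFischerJACM1974, §4, Theorems 2–3 and Algorithm X (time O(|A|·|B|), p. 172)] -/
theorem EditDistance_inTimeO_sq_holds : EditDistance_inTimeO_sq := by
  unfold EditDistance_inTimeO_sq FGProblem.InTimeO FGProblem.InTime FGProblem.InTimeInst
  refine ⟨100, prog, 8, prog_isDeterministic, prog_isOracleFree, ?_⟩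
  rintro ⟨s, t⟩
  refine ⟨[editDist s t], rfl, ?_⟩
  show OutputsWithin prog (8 * inputWidth (encodeBoolPair (s, t))) noOracle zeroCoins
    (encodeBoolPair (s, t)) [editDist s t] ⌊(100 : ℝ) * ((s.length + t.length : ℕ) : ℝ) ^ 2 + 100⌋₊
  have hfloor : ⌊(100 : ℝ) * ((s.length + t.length : ℕ) : ℝ) ^ 2 + 100⌋₊ =
      100 * (s.length + t.length) ^ 2 + 100 := by
    rw [show (100 : ℝ) * ((s.length + t.length : ℕ) : ℝ) ^ 2 + 100 =
      ((100 * (s.length + t.length) ^ 2 + 100 : ℕ) : ℝ) by push_cast; ring]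
    exact Nat.floor_natCast _
  rw [hfloor]
  set x := encodeBoolPair (s, t) with hx
  set w := 8 * inputWidth x with hw_def
  have hw : 2 * s.length + 2 * t.length + 26 + (s.length * (t.length + 1) + (t.length + 1)) ≤
      2 ^ w := wordBound s t
  have hlen : x.length = s.length + t.length + 1 := by
    simp [hx, encodeBoolPair, Nat.add_assoc]
  have hW : inputWidth x ≤ w := inputWidth_le_mul (k := 8) (by norm_num) x
  have hm0 : (init w x).mem 0 = s.length + t.length + 1 := by
    rw [init_mem_zero_of_inputWidth_le hW, hlen]
  have hmem : ∀ a, 1 ≤ a → (init w x).mem a = xv s t (a - 1) := fun a ha => by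
    rw [init_mem_eq_initFun hW]
    exact if_neg (show a ≠ 0 by omega)
  obtain ⟨mem', hrun, hout⟩ := prog_run (O := noOracle) (ρ := zeroCoins) hw rfl (xv_le s t)
    (Elin_le s t) (xv_zero s t) (fun c v h => Elin_lastRow s t h) (fun i hi => Elin_lastCol s t hi)
    (fun i j hi hj => Elin_rec s t hi hj) hm0 hmem 0 []
  rw [Elin_zero] at hout
  rw [← hout]
  refine outputsWithin_of_run (c := ⟨none, mem', 0, []⟩)
    (n := 22 * s.length * t.length + 16 * s.length + 12 * t.length + 43)
    ?_ (step_of_pc_eq_none rfl) (steps_le _ _)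
  rw [init_eq_mk]
  exact hrun

end Literature.Computability.Cryptography
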